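import Mathlib
import Literature.AlgebraicGeometry.Resolution.CobordantGame
import Summits.ResolutionOfSingularities.ResolutionOfSingularities.Theorems.WeightedInvariantLocalWeightedDropMonicRecentre
import Summits.ResolutionOfSingularities.ResolutionOfSingularities.Theorems.WeightedInvariantLocalWeightedDropMonicDoublePointLift
import Summits.ResolutionOfSingularities.ResolutionOfSingularities.Theorems.WeightedInvariantLocalWeightedDropMonicPointBlowupSlot
import Summits.ResolutionOfSingularities.ResolutionOfSingularities.Theorems.WeightedInvariantLocalWeightedDropSeparableTerminalDoublePointsAux

/-!
# `WeightedInvariant.LocalWeightedDrop`, line `hasse-ridge-face-selection`: the POINT STEP on a char-2 monic double point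
# `y² + A₁ y + A₀` with cleaning and the exits built in

Crux item stmt-ResolutionOfSingularities-8899 `LocalWeightedDrop` (route `ResolutionOfSingularities/WeightedInvariant`), serving the
door `WeightedConstruction` stmt-ResolutionOfSingularities-0571.  [OURS · L1 W4.3, chain w43, stub worker 2 (gen 2): first unit of the
reduction piece S2sM `stub_charTwoSeparableReductionWon` (typed sub-cut of S2s, evidence #56 on stmt-8899); usable verbatim by the
inseparable reduction S2iM (`A₁ = 0`); NOT a statement of any manuscript.]

`won_dp1_of_pointStep` (characteristic `2`, `k = k̄`, only the singular ONE-variable germs assumed won): a position `(A₀, A₁)`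
(`ord A₀ ≥ 3`, `ord A₁ ≥ 2`) is won as soon as, for every exceptional point `c ≠ 0` of the point blow-up and the factorisation
`A₁ ∘ chart(c) = s² · B₁`, at SOME live slot `i₀` the caller wins EVERY position `(A₀', A₁')` with `A₁' = (s · B₁)|_{x'_{i₀} ↦ 0}` — the
transported `A₁` (`= s^{ord A₁ - 1}` · strict transform, `CoeffTransport.exists_linearCoeff_transport`) — and ARBITRARY `A₀'` of order
`≥ 3`.  What the step absorbs (`won_dp1_of_singular_of_recentred`): a singular successor `y² + A₁' y + A₀'` either has a non-zero
linear coefficient in `A₁'` or a cross term `x₀x₁` in `A₀'` — then it is won outright (`SepTerminalDoublePoint.won_dp1_of_coeff_*`: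
the char-2 cross-term exit) —, or its quadratic part is `(y)² + (a x₀ + b x₁)²` and the RE-CENTRING `y ↦ y + a x₀ + b x₁`
(`won_monic_two_recentre_iff`; `A₁` is unchanged in characteristic `2`) puts it back into the position space with the same `A₁'`.
So an induction on any measure of `A₁` alone (e.g. the non-normal-crossing count of the plane curve `A₁ = 0`) can be run through the
point step without looking at `A₀`.
-/

set_option linter.dupNamespace false -- mandated namespace of this single-conjunct summit

namespace Summit.ResolutionOfSingularities.ResolutionOfSingularities.Theorems

open Literature.AlgebraicGeometry.Resolution
open Literature.AlgebraicGeometry.Resolution.CobordantGame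

namespace SepPointStep

open MvPowerSeries SepTerminalDoublePoint

variable {k : Type} [Field k]

/-- A series with vanishing constant and linear coefficients has order `> 1`. -/
theorem one_lt_order_of_coeff_eq_zero {A : MvPowerSeries (Fin 2) k} (h0 : constantCoeff A = 0)
    (h1 : ∀ l : Fin 2, coeff (Finsupp.single l 1) A = 0) : (1 : ℕ∞) < A.order := by
  have h2 : ((2 : ℕ) : ℕ∞) ≤ A.order := nat_le_order fun d hd => by
    rcases FormalCoordChange.eq_zero_or_single_of_degree_lt_two d (by exact_mod_cast hd) with rfl | ⟨i, rfl⟩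
    · rw [coeff_zero_eq_constantCoeff_apply]; exact h0
    · exact h1 i
  exact lt_of_lt_of_le (by norm_num) h2

/-- In characteristic `2`: `φ + φ = 0` in `k[[x₀,x₁]]`. -/
theorem add_self_eq_zero [CharP k 2] (φ : MvPowerSeries (Fin 2) k) : φ + φ = 0 := by
  ext d
  rw [map_add, map_zero, CharTwo.add_self_eq_zero]

/-- In characteristic `2` the constant `2` of `k[[x₀,x₁]]` vanishes. -/
theorem two_eq_zero [CharP k 2] : (2 : MvPowerSeries (Fin 2) k) = 0 :=
  calc (2 : MvPowerSeries (Fin 2) k) = 1 + 1 := one_add_one_eq_two.symm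
    _ = 0 := add_self_eq_zero 1

/-- In characteristic `2`: `(a x₀ + b x₁)² = a² x₀² + b² x₁²`. -/
theorem linear_sq [CharP k 2] (a b : k) :
    (C a * X 0 + C b * X 1 : MvPowerSeries (Fin 2) k) ^ 2 = C (a ^ 2) * X 0 ^ 2 + C (b ^ 2) * X 1 ^ 2 := by
  rw [add_sq, two_eq_zero, zero_mul, zero_mul, add_zero, mul_pow, mul_pow, map_pow, map_pow]

/-- `2e₀ ≠ 2e₁`. -/
theorem single_zero_two_ne : (Finsupp.single (0 : Fin 2) 2 : Fin 2 →₀ ℕ) ≠ Finsupp.single 1 2 := fun h => by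
  have h0 := congrArg (fun e => e 0) h
  simp at h0

/-- `e₀ + e₁` is neither `2e₀` nor `2e₁`. -/
theorem cross_ne_single_two (l : Fin 2) :
    (Finsupp.single (0 : Fin 2) 1 + Finsupp.single 1 1 : Fin 2 →₀ ℕ) ≠ Finsupp.single l 2 := fun h => by
  fin_cases l
  · have h1 := congrArg (fun e => e 1) h
    simp at h1
  · have h0 := congrArg (fun e => e 0) h
    simp at h0

/-- Coefficients of `(a x₀ + b x₁)²` below degree `2` vanish. -/
theorem coeff_linear_sq_of_degree_lt_two [CharP k 2] (a b : k) {d : Fin 2 →₀ ℕ} (hd : d.degree < 2) :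
    coeff d ((C a * X 0 + C b * X 1 : MvPowerSeries (Fin 2) k) ^ 2) = 0 := by
  classical
  rw [linear_sq, map_add, coeff_C_mul, coeff_C_mul, coeff_X_pow, coeff_X_pow]
  have h0 : d ≠ Finsupp.single 0 2 := fun h => by rw [h, Finsupp.degree_single] at hd; exact absurd hd (by norm_num)
  have h1 : d ≠ Finsupp.single 1 2 := fun h => by rw [h, Finsupp.degree_single] at hd; exact absurd hd (by norm_num)
  rw [if_neg h0, if_neg h1, mul_zero, mul_zero, add_zero]

/-- `[x₀²] (a x₀ + b x₁)² = a²`. -/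
theorem coeff_linear_sq_two_zero [CharP k 2] (a b : k) :
    coeff (Finsupp.single 0 2) ((C a * X 0 + C b * X 1 : MvPowerSeries (Fin 2) k) ^ 2) = a ^ 2 := by
  classical
  rw [linear_sq, map_add, coeff_C_mul, coeff_C_mul, coeff_X_pow, coeff_X_pow, if_pos rfl, if_neg single_zero_two_ne,
    mul_one, mul_zero, add_zero]

/-- `[x₁²] (a x₀ + b x₁)² = b²`. -/
theorem coeff_linear_sq_two_one [CharP k 2] (a b : k) :
    coeff (Finsupp.single 1 2) ((C a * X 0 + C b * X 1 : MvPowerSeries (Fin 2) k) ^ 2) = b ^ 2 := by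
  classical
  rw [linear_sq, map_add, coeff_C_mul, coeff_C_mul, coeff_X_pow, coeff_X_pow, if_neg single_zero_two_ne.symm, if_pos rfl,
    mul_zero, mul_one, zero_add]

/-- `[x₀x₁] (a x₀ + b x₁)² = 0` (characteristic `2`: no cross term). -/
theorem coeff_linear_sq_cross [CharP k 2] (a b : k) :
    coeff (Finsupp.single 0 1 + Finsupp.single 1 1) ((C a * X 0 + C b * X 1 : MvPowerSeries (Fin 2) k) ^ 2) = 0 := by
  classical
  rw [linear_sq, map_add, coeff_C_mul, coeff_C_mul, coeff_X_pow, coeff_X_pow, if_neg (cross_ne_single_two 0),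
    if_neg (cross_ne_single_two 1), mul_zero, mul_zero, add_zero]

/-- `eᵢ + eᵢ = 2eᵢ`. -/
theorem single_one_add_self (i : Fin 2) : (Finsupp.single i 1 + Finsupp.single i 1 : Fin 2 →₀ ℕ) = Finsupp.single i 2 := by
  rw [← Finsupp.single_add]

/-- For `i ≠ j` in `Fin 2`, `eᵢ + eⱼ = e₀ + e₁`. -/
theorem single_add_single_of_ne {i j : Fin 2} (h : i ≠ j) :
    (Finsupp.single i 1 + Finsupp.single j 1 : Fin 2 →₀ ℕ) = Finsupp.single 0 1 + Finsupp.single 1 1 := by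
  fin_cases i <;> fin_cases j
  · exact absurd rfl h
  · rfl
  · exact add_comm _ _
  · exact absurd rfl h

/-- THE CLEANED CONSTANT COEFFICIENT HAS ORDER `≥ 3`.  If `A₀(0) = 0`, `A₀` has no linear terms and no `x₀x₁` term, `ord A₁ ≥ 2`,
and `a² = [x₀²]A₀`, `b² = [x₁²]A₀`, then `A₀ + A₁·(a x₀ + b x₁) + (a x₀ + b x₁)²` has order `> 2` (characteristic `2`). -/
theorem two_lt_order_recentred [CharP k 2] {A₀ A₁ : MvPowerSeries (Fin 2) k} (h0 : constantCoeff A₀ = 0)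
    (h1 : ∀ l : Fin 2, coeff (Finsupp.single l 1) A₀ = 0) (hx : coeff (Finsupp.single 0 1 + Finsupp.single 1 1) A₀ = 0)
    (hA₁ : (1 : ℕ∞) < A₁.order) {a b : k} (ha : coeff (Finsupp.single 0 2) A₀ = a * a)
    (hb : coeff (Finsupp.single 1 2) A₀ = b * b) :
    (2 : ℕ∞) < (A₀ + A₁ * (C a * X 0 + C b * X 1) + (C a * X 0 + C b * X 1) ^ 2).order := by
  classical
  have hφ0 : constantCoeff (C a * X 0 + C b * X 1 : MvPowerSeries (Fin 2) k) = 0 := by simp [constantCoeff_X]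
  -- `A₁ φ` has order `≥ 3`
  have hordφ : (1 : ℕ∞) ≤ (C a * X 0 + C b * X 1 : MvPowerSeries (Fin 2) k).order :=
    one_le_order_iff_constCoeff_eq_zero.mpr hφ0
  have hord3 : ((3 : ℕ) : ℕ∞) ≤ (A₁ * (C a * X 0 + C b * X 1)).order := by
    have h2 : (2 : ℕ∞) ≤ A₁.order := Order.add_one_le_of_lt hA₁
    have h := le_trans (add_le_add h2 hordφ) (le_order_mul (f := A₁) (g := (C a * X 0 + C b * X 1)))
    have h3 : ((3 : ℕ) : ℕ∞) = 2 + 1 := by norm_num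
    rw [h3]
    exact h
  have h3 : ((3 : ℕ) : ℕ∞) ≤ (A₀ + A₁ * (C a * X 0 + C b * X 1) + (C a * X 0 + C b * X 1) ^ 2).order :=
      nat_le_order fun d hd => by
    have hmid : coeff d (A₁ * (C a * X 0 + C b * X 1)) = 0 :=
      coeff_of_lt_order (lt_of_lt_of_le (by exact_mod_cast hd) hord3)
    rw [map_add, map_add, hmid, add_zero]
    by_cases hd2 : d.degree < 2
    · rw [coeff_linear_sq_of_degree_lt_two a b hd2, add_zero]
      rcases FormalCoordChange.eq_zero_or_single_of_degree_lt_two d hd2 with rfl | ⟨i, rfl⟩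
      · rw [coeff_zero_eq_constantCoeff_apply]; exact h0
      · exact h1 i
    · have hdeg : d.degree = 2 := by omega
      obtain ⟨i, j, rfl⟩ := ConeDichotomy.exists_eq_single_add_single d hdeg
      by_cases hij : i = j
      · subst hij
        rw [single_one_add_self]
        fin_cases i
        · simp only [Fin.zero_eta, Fin.isValue]
          rw [coeff_linear_sq_two_zero, ha, ← sq, CharTwo.add_self_eq_zero]
        · simp only [Fin.mk_one, Fin.isValue]
          rw [coeff_linear_sq_two_one, hb, ← sq, CharTwo.add_self_eq_zero]
      · rw [single_add_single_of_ne hij, hx, coeff_linear_sq_cross, add_zero]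
  exact lt_of_lt_of_le (by norm_num) h3

/-- AFTER THE STEP (characteristic `2`, `k = k̄`): a SINGULAR `y² + A₁' y + A₀'` is won as soon as every position `(A₀'', A₁')`
— the same `A₁'`, any `A₀''` of order `≥ 3`, provided `ord A₁' ≥ 2` — is won.  Either `A₁'` has a non-zero linear coefficient or `A₀'`
has the cross term `x₀x₁` (then the successor is won outright by the cross-term exit), or the quadratic part of `A₀'` is a square
`(a x₀ + b x₁)²` and the re-centring `y ↦ y + a x₀ + b x₁` (legal, `won_monic_two_recentre_iff`; `A₁'` unchanged) produces such a
position. -/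
theorem won_dp1_of_singular_of_recentred [CharP k 2] [IsAlgClosed k]
    (hlow : ∀ g : MvPowerSeries (Fin 1) k, CobordantGame.IsSingular k g → CobordantGame.Won k 1 g)
    {A₀' A₁' : MvPowerSeries (Fin 2) k}
    (hS : CobordantGame.IsSingular k (X (Fin.last 2) ^ 2 + (rename (Fin.succAboveEmb (Fin.last 2)) A₀' +
      rename (Fin.succAboveEmb (Fin.last 2)) A₁' * X (Fin.last 2))))
    (hW : ∀ A₀'' : MvPowerSeries (Fin 2) k, (2 : ℕ∞) < A₀''.order → (1 : ℕ∞) < A₁'.order →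
      CobordantGame.Won k 3 (X (Fin.last 2) ^ 2 + (rename (Fin.succAboveEmb (Fin.last 2)) A₀'' +
        rename (Fin.succAboveEmb (Fin.last 2)) A₁' * X (Fin.last 2)))) :
    CobordantGame.Won k 3 (X (Fin.last 2) ^ 2 + (rename (Fin.succAboveEmb (Fin.last 2)) A₀' +
      rename (Fin.succAboveEmb (Fin.last 2)) A₁' * X (Fin.last 2))) := by
  classical
  by_cases hl : ∃ l : Fin 2, coeff (Finsupp.single l 1) A₁' ≠ 0
  · obtain ⟨l, hl⟩ := hl
    exact won_dp1_of_coeff_single_A₁_ne_zero hlow hS l hl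
  push Not at hl
  by_cases hx : coeff (Finsupp.single 0 1 + Finsupp.single 1 1) A₀' ≠ 0
  · exact won_dp1_of_coeff_cross_A₀_ne_zero hlow hS hx
  push Not at hx
  have hA₁0 : constantCoeff A₁' = 0 := by rw [← coeff_single_last_dp1 A₀' A₁']; exact hS.2.2 _
  have hA₁ord : (1 : ℕ∞) < A₁'.order := one_lt_order_of_coeff_eq_zero hA₁0 hl
  have hA₀0 : constantCoeff A₀' = 0 := by rw [← constantCoeff_dp1 A₀' A₁']; exact hS.2.1
  have hA₀1 : ∀ l : Fin 2, coeff (Finsupp.single l 1) A₀' = 0 := fun l => by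
    rw [← coeff_single_castSucc_dp1 A₀' A₁' l 1]; exact hS.2.2 _
  obtain ⟨a, ha⟩ := IsAlgClosed.exists_eq_mul_self (coeff (Finsupp.single 0 2) A₀')
  obtain ⟨b, hb⟩ := IsAlgClosed.exists_eq_mul_self (coeff (Finsupp.single 1 2) A₀')
  set φ : MvPowerSeries (Fin 2) k := C a * X 0 + C b * X 1 with hφ
  have hφ0 : constantCoeff φ = 0 := by simp [hφ, constantCoeff_X]
  have hord := two_lt_order_recentred hA₀0 hA₀1 hx hA₁ord ha hb
  have hWin := hW (A₀' + A₁' * φ + φ ^ 2) hord hA₁ord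
  have h2φ : A₁' + 2 * φ = A₁' := by rw [two_eq_zero, zero_mul, add_zero]
  refine (won_monic_two_recentre_iff φ hφ0 A₀' A₁').mp ?_
  rw [h2φ]
  exact hWin

/-- THE POINT STEP WITH CLEANING (characteristic `2`, `k = k̄`; only the singular one-variable germs assumed won).  A position
`y² + A₁ y + A₀` (`ord A₀ ≥ 3`, `ord A₁ ≥ 2`) is won as soon as for every exceptional point `c ≠ 0` of the point blow-up and the
factorisation `A₁ ∘ chart(c) = s² · B₁` there is a live slot `i₀` (`c_{i₀} ≠ 0`) at which EVERY position with linear coefficient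
`A₁' = (s · B₁)|_{x'_{i₀} ↦ 0}` (and arbitrary `A₀'` of order `≥ 3`) is won. -/
theorem won_dp1_of_pointStep [CharP k 2] [IsAlgClosed k]
    (hlow : ∀ g : MvPowerSeries (Fin 1) k, CobordantGame.IsSingular k g → CobordantGame.Won k 1 g)
    (A₀ A₁ : MvPowerSeries (Fin 2) k) (h₀ : (2 : ℕ∞) < A₀.order) (h₁ : (1 : ℕ∞) < A₁.order)
    (hsucc : ∀ c : Fin 2 → k, (∃ i, c i ≠ 0) → ∀ B₁ : MvPowerSeries (Fin 3) k,
      MvPowerSeries.subst (CobordantChart.chart (fun _ : Fin 2 => 1) c) A₁ = MvPowerSeries.X 0 ^ 2 * B₁ →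
      ∃ i₀ : Fin 2, c i₀ ≠ 0 ∧ ∀ A₀' : MvPowerSeries (Fin 2) k, (2 : ℕ∞) < A₀'.order →
        (1 : ℕ∞) < (TupleGame.slice i₀ (MvPowerSeries.X 0 * B₁)).order →
        CobordantGame.Won k 3 (X (Fin.last 2) ^ 2 + (rename (Fin.succAboveEmb (Fin.last 2)) A₀' +
          rename (Fin.succAboveEmb (Fin.last 2)) (TupleGame.slice i₀ (MvPowerSeries.X 0 * B₁)) * X (Fin.last 2)))) :
    CobordantGame.Won k 3 (X (Fin.last 2) ^ 2 + (rename (Fin.succAboveEmb (Fin.last 2)) A₀ +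
      rename (Fin.succAboveEmb (Fin.last 2)) A₁ * X (Fin.last 2))) := by
  classical
  rw [MonicDoublePointLift.monic_two_eq_sum A₀ A₁]
  refine won_monic_of_pointBlowup_slot 2 Nat.prime_two k 2 2 two_pos (![A₀, A₁]) ?_ ?_
  · intro j
    fin_cases j
    · simpa using h₀
    · simpa using h₁
  · intro c hc B hB
    obtain ⟨i₀, hci₀, hW⟩ := hsucc c hc (B 1) (by simpa using hB 1)
    refine ⟨i₀, hci₀, fun hS => ?_⟩
    have hSeq : X (Fin.last 2) ^ 2 + ∑ j : Fin 2, rename (Fin.succAboveEmb (Fin.last 2))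
        (TupleGame.slice i₀ (X 0 * B j)) * X (Fin.last 2) ^ (j : ℕ) =
        X (Fin.last 2) ^ 2 + (rename (Fin.succAboveEmb (Fin.last 2)) (TupleGame.slice i₀ (X 0 * B 0)) +
          rename (Fin.succAboveEmb (Fin.last 2)) (TupleGame.slice i₀ (X 0 * B 1)) * X (Fin.last 2)) := by
      rw [Fin.sum_univ_two]
      simp only [Fin.val_zero, Fin.val_one, pow_zero, mul_one, pow_one]
    rw [hSeq] at hS ⊢
    exact won_dp1_of_singular_of_recentred hlow hS hW

end SepPointStep

end Summit.ResolutionOfSingularities.ResolutionOfSingularities.Theorems
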